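import Mathlib
import HarnessLib
import Summits.HubbardSuperconductivity.HubbardSuperconductivity.Theorems.KLProgrammeKLRegimeEngineV8DefsQ3

/-!
# K3 engine child (`KLRegimeEngineV14`, stmt-HubbardSuperconductivity-19918), stub `stub_engine_scale0`, clause (E1-v4)₀: the frame-size
# condition `(16/15)·Gfr0·|U| ≤ 1/50` holds below the engine threshold `klEngU₀3`

Cell gate-hubbard-kl, seat hubbard-kl-k3c2-p1.  One of the two `U`-conditions of `kernelNormsV4_zero_of_klEng`
(`Theorems/KLProgrammeKLRegimeEngineScaleZeroExplicit/…E1Final`: `(16/15)·Gfr0·|U| ≤ 1/50`, the `κ = sup|K| ≤ 1/50` input of the scale-`0`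
symbol geometry) discharged from the engine's binder `0 < U ≤ klEngU₀3 P R c` (`= 1/(2^{120}·Psq²·Rsq⁴·(c²+1))`, `Rsq = klEngRsq R ≥ Gfr0`,
`Psq ≥ 1`): `Gfr0·U ≤ 2^{-120}`.

* **`gfr0_abs_mul_le_of_le_klEngU₀3`**.

Everything is proved; no definitions, no named facts, no sorry.
-/

noncomputable section

namespace Summit.HubbardSuperconductivity.HubbardSuperconductivity.Theorems.EngineV8

set_option linter.dupNamespace false -- summit = problem name (single-conjunct summit), D-0017

open Real Finset
open Summit.HubbardSuperconductivity.HubbardSuperconductivity.Theorems.KLRegimeSplit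

/-- **`(16/15)·Gfr0·|U| ≤ 1/50` below `klEngU₀3`**: for `0 < U ≤ klEngU₀3 P R c` (any `Gfr0`, since `Gfr0 ≤ klEngRsq R`). -/
theorem gfr0_abs_mul_le_of_le_klEngU₀3 {P : SplitConsts} {R : RenConsts} {c U : ℝ} (hU : 0 < U)
    (hU₀ : U ≤ klEngU₀3 P R c) : 16 / 15 * (R.Gfr 0 * |U|) ≤ 1 / 50 := by
  have hRsq1 : 1 ≤ klEngRsq R := one_le_klEngRsq R
  have hPsq1 : 1 ≤ klEngPsq P := one_le_klEngPsq P
  have hG : R.Gfr 0 ≤ klEngRsq R := gfr_le_klEngRsq R (by norm_num)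
  rw [abs_of_pos hU]
  -- `U ≤ 1/(2^120 · Rsq)`
  have hden : (2 : ℝ) ^ 120 * klEngRsq R ≤ (2 : ℝ) ^ 120 * klEngPsq P ^ 2 * klEngRsq R ^ 4 * (c ^ 2 + 1) := by
    have h1 : klEngRsq R ≤ klEngRsq R ^ 4 := by
      calc klEngRsq R = klEngRsq R * 1 * 1 * 1 := by ring
        _ ≤ klEngRsq R * klEngRsq R * klEngRsq R * klEngRsq R := by gcongr
        _ = klEngRsq R ^ 4 := by ring
    have h2 : (1 : ℝ) ≤ klEngPsq P ^ 2 := one_le_pow₀ hPsq1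
    have h3 : (1 : ℝ) ≤ c ^ 2 + 1 := by nlinarith [sq_nonneg c]
    have hR0 : 0 ≤ klEngRsq R := by linarith
    calc (2 : ℝ) ^ 120 * klEngRsq R = (2 : ℝ) ^ 120 * 1 * klEngRsq R * 1 := by ring
      _ ≤ (2 : ℝ) ^ 120 * klEngPsq P ^ 2 * klEngRsq R ^ 4 * (c ^ 2 + 1) := by gcongr
  have hUle : U ≤ 1 / ((2 : ℝ) ^ 120 * klEngRsq R) := by
    refine hU₀.trans ?_
    rw [klEngU₀3]
    exact one_div_le_one_div_of_le (by positivity) hden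
  have hGU : R.Gfr 0 * U ≤ klEngRsq R * (1 / ((2 : ℝ) ^ 120 * klEngRsq R)) :=
    mul_le_mul hG hUle hU.le (by linarith)
  have hval : klEngRsq R * (1 / ((2 : ℝ) ^ 120 * klEngRsq R)) = 1 / (2 : ℝ) ^ 120 := by
    field_simp
  rw [hval] at hGU
  have h120 : (1 : ℝ) / 2 ^ 120 ≤ 3 / 160 := by norm_num
  linarith

end Summit.HubbardSuperconductivity.HubbardSuperconductivity.Theorems.EngineV8

end
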